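import Summits.BirchSwinnertonDyer.BirchSwinnertonDyer.Theorems.PrintCf2RubinValueTwoDualTransposeLinear
import Summits.BirchSwinnertonDyer.BirchSwinnertonDyer.Theorems.PrintCf2RubinValueTwoTwoVariableMCOfCoinvariants
import Summits.BirchSwinnertonDyer.BirchSwinnertonDyer.Theorems.PrintCf2RubinValueTwoTwoVariableMCSemilocalColemanTwoVar
import Literature.Algebra.Module.CharacterModuleAnnihilator
import HarnessLib

/-!
# Transposes with FINITE defects: `#coker g < ∞ ⟹ #ker Φ < ∞` and `#ker g < ∞ ⟹ #coker Φ < ∞` for the transpose `Φ`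
# of an additive `g : T → S` between Pontryagin-dual data — and, over `Λ₂`, finite ⟹ pointwise pseudo-null:
# the comparison-map hypotheses `hsXker` / `hsXcoker` / `hsAker` of the CFT-currency socket

Cell `bsd-print-cf2`, width seat `bsd-line-cf2c-w6` g2 (AUTOFILL #2 PART 2 item (3)), brick §4(d) of the LEAD memo
`Cruxes/SplitBadTwoRankOneOfFacts/RULING-B23-g13.md` for crux `PrintCf2RubinValueTwo.TwoVariableMainConjAtSplitTwo`
(stmt-BirchSwinnertonDyer-23720, S3a), part II (i). The socket `ClassGroupQuotient.map_charIdeal_dual_eq_span_of_coinvariant_fourTerm`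
(p689803) takes comparison maps `sX : X(𝔎_∞)_θ → D.X`, `sA : A(𝔎_∞)_θ → C.X` with POINTWISE pseudo-null kernel / cokernel. In the
intended instantiation these are TRANSPOSES (g0's `DualTranspose.exists_linearMap_transpose`) of restriction maps between discrete
Selmer groups whose kernel and cokernel are FINITE (inflation–restriction along `Δ′ = Gal(𝔎_∞/K̃_∞)` with coefficients in
`A_θ ≅ ℚ_p/ℤ_p`: `H¹(Δ′, A_θ)`, `H²(Δ′, A_θ)` are finite). This file turns «finite kernel/cokernel of `g`» into exactly those
hypotheses:

* §1 (pure Pontryagin algebra, `A = ℚ/ℤ = AddCircle (1 : ℚ)`; `dS`, `dT` the dual-data identifications, `dT (Φ x) = dS x ∘ g`):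
  **`finite_ker_transpose_of_finite_quotient_range`** (`S/g(T)` finite ⟹ `ker Φ` finite: `ker Φ ↪ (S/g(T))^∨`) and
  **`finite_quotient_range_transpose_of_finite_ker`** (`ker g` finite ⟹ `XT/Φ(XS)` finite: `↪ (ker g)^∨`, characters of `T`
  killing `ker g` extend through `g` — `CharacterModule.dual_surjective_of_injective` on `T/ker g ↪ S`); finiteness of `M^∨` for
  finite `M` is the tree's `Literature.Algebra.Module.natCard_characterModule_le`;
* §2 (`Λ₂ = ℤ_p⟦T₂⟧⟦T₁⟧`): **`isPseudoNull_iwasawaAlgebra₂_of_finite`** (a finite `Λ₂`-module is pseudo-null — cf2c-w7's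
  `SemilocalColeman.isPseudoNull_iwasawaAlgebraTwoVar_of_moduleFinite_padicInt` with the `ℤ_p`-structure through `C ∘ C`), and
  the pointwise read-outs `exists_smul_eq_zero_of_finite_ker`, `exists_smul_mem_range_of_finite_quotient` — the literal shapes
  of `hsXker`, `hsAker`, `hsXcoker`.

THEOREMS ONLY (no `def`, no named fact, no `sorry`); Theses-free; nothing about any curve or field; `--supports` the crux as a
helper. BSD is not proved by any of this; no summit statement is proved here.

References: K. Rubin, Invent. Math. 103 (1991), §4–§6 [Rubin1991]; R. Greenberg, LNM 1716 (1999), §1 [GreenbergLNM1716];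
Neukirch–Schmidt–Wingberg V §1 (5.1.4) Remark 4 (finite ⟹ pseudo-null) [NeukirchSchmidtWingberg2008].
-/

noncomputable section

set_option linter.dupNamespace false -- D-0017: single-problem summit, `…BirchSwinnertonDyer.BirchSwinnertonDyer…` repeats a namespace by design
set_option autoImplicit false

open scoped Classical

/-! ## §1. Finite defects of transposes -/

namespace Summit.BirchSwinnertonDyer.BirchSwinnertonDyer.Theorems.PrintCf2.DualTranspose

universe u₃ u₄

-- `S`, `T` in `Type`: the tree's Selmer groups (and `Literature.Algebra.Module.natCard_characterModule_le`) live there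
variable {S : Type} [AddCommGroup S] {T : Type} [AddCommGroup T] (g : T →+ S)
  {R : Type*} [Ring R] {XS : Type u₃} [AddCommGroup XS] [Module R XS] {XT : Type u₄} [AddCommGroup XT] [Module R XT]
  {dS : XS →+ (S →+ AddCircle (1 : ℚ))} {dT : XT →+ (T →+ AddCircle (1 : ℚ))}

/-- **`S/g(T)` finite ⟹ `ker Φ` finite** for the transpose `Φ` of `g` (`dT (Φ x) = dS x ∘ g`, `dS` and `dT` injective):
`ker Φ` = the `x` whose character kills `g(T)` (`transpose_eq_zero_iff`), and `x ↦ dS x` factored through `S/g(T)` embeds it into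
the finite group `(S/g(T))^∨`. Dually: a restriction map with finite cokernel has a transpose with finite kernel.
[cite: GreenbergLNM1716, §1 (after Conj. 1.3)] -/
theorem finite_ker_transpose_of_finite_quotient_range (Φ : XS →ₗ[R] XT) (hΦ : ∀ x, dT (Φ x) = (dS x).comp g)
    (hbS : Function.Injective dS) (hbT : Function.Injective dT) [Finite (S ⧸ g.range)] :
    Finite (LinearMap.ker Φ) := by
  haveI : Finite (S ⧸ g.range →+ AddCircle (1 : ℚ)) :=
    (Literature.Algebra.Module.natCard_characterModule_le (M := S ⧸ g.range)).1
  have hkill : ∀ x : LinearMap.ker Φ, g.range ≤ (dS (x : XS)).ker := by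
    rintro x _ ⟨t, rfl⟩
    exact (transpose_eq_zero_iff (g := g) Φ.toAddMonoidHom hΦ hbT (x : XS)).mp (LinearMap.mem_ker.mp x.2) t
  let ψ : LinearMap.ker Φ → (S ⧸ g.range →+ AddCircle (1 : ℚ)) :=
    fun x ↦ QuotientAddGroup.lift g.range (dS (x : XS)) (hkill x)
  refine Finite.of_injective ψ fun x x' h ↦ Subtype.ext (hbS ?_)
  ext s
  have := DFunLike.congr_fun h (QuotientAddGroup.mk s)
  simpa [ψ] using this

/-- **`ker g` finite ⟹ `XT/Φ(XS)` finite** for the transpose `Φ` of `g` (`dS` surjective, `dT` injective): restriction to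
`ker g` gives an injection `XT/Φ(XS) ↪ (ker g)^∨`, because a character of `T` killing `ker g` factors through `T/ker g ↪ S`
and extends to `S` (`ℚ/ℤ` divisible), i.e. comes from `Φ`. Dually: a restriction map with finite kernel has a transpose with
finite cokernel. [cite: GreenbergLNM1716, §1 (after Conj. 1.3)] -/
theorem finite_quotient_range_transpose_of_finite_ker (Φ : XS →ₗ[R] XT) (hΦ : ∀ x, dT (Φ x) = (dS x).comp g)
    (hbS : Function.Surjective dS) (hbT : Function.Injective dT) [Finite g.ker] :
    Finite (XT ⧸ LinearMap.range Φ) := by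
  haveI : Finite (g.ker →+ AddCircle (1 : ℚ)) :=
    (Literature.Algebra.Module.natCard_characterModule_le (M := g.ker)).1
  -- a character of `T` killing `ker g` comes from `XS`
  have key : ∀ y : XT, (dT y).comp g.ker.subtype = 0 → y ∈ LinearMap.range Φ := by
    intro y hy
    have hle : g.ker ≤ (dT y).ker := fun t ht ↦ by
      simpa using DFunLike.congr_fun hy ⟨t, ht⟩
    obtain ⟨χ, hχ⟩ := CharacterModule.dual_surjective_of_injective (QuotientAddGroup.kerLift g).toIntLinearMap
      (QuotientAddGroup.kerLift_injective g) (QuotientAddGroup.lift g.ker (dT y) hle)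
    obtain ⟨x, hx⟩ := hbS χ
    refine ⟨x, hbT ?_⟩
    rw [hΦ, hx]
    ext t
    rw [AddMonoidHom.comp_apply, ← QuotientAddGroup.kerLift_mk g t]
    change (CharacterModule.dual (QuotientAddGroup.kerLift g).toIntLinearMap χ) (QuotientAddGroup.mk t) = _
    rw [hχ]
    exact QuotientAddGroup.lift_mk (N := g.ker) hle t
  -- restriction to `ker g`, factored through the cokernel
  let F : XT → (g.ker →+ AddCircle (1 : ℚ)) := fun y ↦ (dT y).comp g.ker.subtype
  have hF : ∀ y y' : XT, (LinearMap.range Φ).quotientRel y y' → F y = F y' := by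
    intro y y' h
    rw [Submodule.quotientRel_def] at h
    obtain ⟨x, hx⟩ := h
    have : F (y - y') = 0 := by
      ext ⟨t, ht⟩
      simp only [F, ← hx, hΦ, AddMonoidHom.comp_apply, AddSubgroup.coe_subtype, AddMonoidHom.zero_apply,
        AddMonoidHom.mem_ker.mp ht, map_zero]
    simpa [F, map_sub, sub_eq_zero] using this
  let ψ : XT ⧸ LinearMap.range Φ → (g.ker →+ AddCircle (1 : ℚ)) := Quotient.lift F hF
  refine Finite.of_injective ψ fun q q' h ↦ ?_
  obtain ⟨y, rfl⟩ := Submodule.Quotient.mk_surjective _ q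
  obtain ⟨y', rfl⟩ := Submodule.Quotient.mk_surjective _ q'
  rw [Submodule.Quotient.eq]
  apply key
  have h' : F y = F y' := h
  rw [map_sub, AddMonoidHom.sub_comp, sub_eq_zero]
  exact h'

end Summit.BirchSwinnertonDyer.BirchSwinnertonDyer.Theorems.PrintCf2.DualTranspose

/-! ## §2. Over `Λ₂`: finite ⟹ pointwise pseudo-null -/

namespace Summit.BirchSwinnertonDyer.BirchSwinnertonDyer.Theorems.PrintCf2.FourTerm

open Literature.NumberTheory.EllipticCurves

universe u₁ u₂

variable {p : ℕ} [Fact p.Prime] {M : Type u₁} [AddCommGroup M] [Module (IwasawaAlgebra₂ p) M]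
  {N : Type u₂} [AddCommGroup N] [Module (IwasawaAlgebra₂ p) N]

/-- **A finite `Λ₂`-module is pseudo-null** (it is finitely generated over `ℤ_p ⊂ Λ₂`, so cf2c-w7's
`SemilocalColeman.isPseudoNull_iwasawaAlgebraTwoVar_of_moduleFinite_padicInt` applies with the `ℤ_p`-structure `a ↦ C (C a)`).
[cite: NeukirchSchmidtWingberg2008, Ch. V §1, (5.1.4) Remark 4] -/
theorem isPseudoNull_iwasawaAlgebra₂_of_finite (M : Type u₁) [AddCommGroup M] [Module (IwasawaAlgebra₂ p) M] [Finite M] :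
    Module.IsPseudoNull (IwasawaAlgebra₂ p) M := by
  letI : Module ℤ_[p] M := Module.compHom M
    ((PowerSeries.C (R := IwasawaAlgebra p)).comp (PowerSeries.C (R := ℤ_[p])))
  exact SemilocalColeman.isPseudoNull_iwasawaAlgebraTwoVar_of_moduleFinite_padicInt (p := p) (fun _ _ ↦ rfl)

/-- Pointwise read-out, kernel form (`hsXker` / `hsAker` of the socket): a `Λ₂`-linear map with FINITE kernel has pointwise
pseudo-null kernel. [cite: NeukirchSchmidtWingberg2008, Ch. V §1, (5.1.4) Remark 4] -/
theorem exists_smul_eq_zero_of_finite_ker (f : M →ₗ[IwasawaAlgebra₂ p] N) [Finite (LinearMap.ker f)]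
    {𝔭 : PrimeSpectrum (IwasawaAlgebra₂ p)} (h𝔭 : 𝔭.asIdeal.height ≤ 1) {x : M} (hx : f x = 0) :
    ∃ r ∉ 𝔭.asIdeal, r • x = 0 :=
  exists_smul_eq_zero_of_isPseudoNull_submodule (isPseudoNull_iwasawaAlgebra₂_of_finite _) h𝔭
    (LinearMap.mem_ker.mpr hx)

/-- Pointwise read-out, cokernel form (`hsXcoker` of the socket): a `Λ₂`-linear map with FINITE cokernel has pointwise
pseudo-null cokernel: every `y` has `r • y ∈ range f` for some `r ∉ 𝔭`. [cite: NeukirchSchmidtWingberg2008, Ch. V §1, (5.1.4) Remark 4] -/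
theorem exists_smul_mem_range_of_finite_quotient (f : M →ₗ[IwasawaAlgebra₂ p] N)
    [Finite (N ⧸ LinearMap.range f)] {𝔭 : PrimeSpectrum (IwasawaAlgebra₂ p)} (h𝔭 : 𝔭.asIdeal.height ≤ 1)
    (y : N) : ∃ r ∉ 𝔭.asIdeal, r • y ∈ LinearMap.range f := by
  have hs := isPseudoNull_iwasawaAlgebra₂_of_finite (N ⧸ LinearMap.range f) 𝔭 h𝔭
  rw [LocalizedModule.subsingleton_iff] at hs
  obtain ⟨r, hr, h0⟩ := hs (Submodule.Quotient.mk y)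
  refine ⟨r, hr, ?_⟩
  rw [← Submodule.Quotient.mk_smul, Submodule.Quotient.mk_eq_zero] at h0
  exact h0

end Summit.BirchSwinnertonDyer.BirchSwinnertonDyer.Theorems.PrintCf2.FourTerm

end
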